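import Summits.QuantumFields.YangMills.Theorems.BalabanUVNodesN18KingModelScalesPair

/-!
# BalabanUVNodes ∕ N18 — King's (3.75), SECOND line: the Hölder quotient of the LATTICE DERIVATIVE `∂_α(x, y)∂^η_μG_{(j)}`,
# `j ≥ 1`, for King's ACTUAL operators on Bałaban's tori, UNCONDITIONAL — n18-b's file 13 §5–§6 (`holder_dkernel_decay_blocks`,
# `king_prop38_holder_deriv_torus_blocks` = (3.71) line 4 in its printed shape) consumed BY NAME through the pair-anchored knit
# `N18KingModelScalesPair` ⟹ a MULTI-SCALE inhabitant of `T4OutputRate.NE5` with `θ = L^{−γ∕2} < 1`, `κ > 0` (Track A, DAG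
# node N18 = NE5 `T4OutputRate.NE5 EA EB W κ θ C₅` :211; cluster K4; the -a∕-b loop on the PRINTED MODEL, fifth display;
# sibling of `BalabanUVNodesN18KingModelTorusHolder` = (3.75) first line)

HONEST FRAMING.  Count-neutral kernel bookkeeping (seat pub-ymgap-dag-n18-a g5; `--supports stmt-QuantumFields-19182`).
King's A = 0 scalar MODEL of the NE5 mechanism (template literature, published and proved) — NOT Bałaban's covariant
one-step outputs `E^{(j)}(X; g, U)`, for which NE5 is NOT IN PRINT and has no tree producer (NODE O 0∕1); NOT a node
discharge; finite tori; nothing continuum ∕ ℝ⁴ ∕ OS ∕ mass-gap ∕ Clay.  THEOREMS ONLY: 0 `def`, 0 `sorry`, standard axioms.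

THE POINT.  King p. 665, Prop. 3.9 (3.75), second entry: «|(∂_α(x′, y′)∂^{η′}_μG^{η′}_{(j)})(z′) − (∂_α(x, y)∂^η_μG^η_{(j)})(z)|
≦ CL^{−γk}(L^jη)^{1−d−α−γ} exp[−δ₀ dist({x, y}, z)]».  In the (4.42) expansion the row is
`u ↦ |x − y|^{−α}(∂^η_μℋ_j(x, u) − ∂^η_μℋ_j(y, u))`, `∂^η_μℋ_j(x, u) = L^j(ℋ_j(x + e_μ, u) − ℋ_j(x, u))`, pair-anchored at `{B(x), B(y)}`;
its decay and rate are n18-b's `holder_dkernel_decay_blocks` ∕ `king_prop38_holder_deriv_torus_blocks` (file 13, `α + γ < 1` —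
King's «α + γ < 1» for the fourth line), the column is file 8's `minimiser_col_decay` ∕ `minimiser_row_rate`, the middle line and
the assembly are `N18KingModelScalesPair.ne5_of_threeFactorRates_lemma45_pair`, the constants are made `K, n`-free by
`fprop38Const_le_unif` (at `β = α + 1`) ∕ `sqrt_rate_le_unif`:
* §1 **`ne5_kingModel_threeFactorHolderDeriv_torus`** — `∃ κ > 0, C₅ ≥ 0 (d, L, a, m², γ, α only) ∀ n ≥ 1 ∀ tori ∀ carriers
  (scale ≥ 1; a direction μ(X); three fine points x_A, y_A, z_A under x_B, y_B, z_B; d X ≤ min(|B(x_A) − B(z_A)|,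
  |B(y_A) − B(z_A)|)) ∀ read-outs ∀ W, NE5 EA EB W κ (L^{−γ∕2}) C₅`.
A literal inhabitant is built exactly as in the sibling's §2 (add the direction to the domain); not repeated here.
NOT COVERED ∕ PINS (standing, ref-B READ #66∕#73∕#110∕#238): A = 0, `g`∕`U` unread; periodic b.c.; the `j = 0` piece; King's
rescaling (2.20) and the powers `(L^jη)^{…}`; sup torus distance in unit coordinates for `|x − y|`; (3.74); vertex functions;
the bearing on Bałaban's `E^{(j)}(X; g, U)` is NIL (NODE O + rows NE2∕NE3).

Sources: C. King, Commun. Math. Phys. **102** (1986) 649–677 [King1986] — Prop. 3.9 (3.75) p. 665, (3.62) p. 663, (4.42)–(4.43)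
p. 675, Prop. 3.8 (3.71) p. 664, Lemma 4.5 (4.38) p. 674, Thm 3.3 (3.8) p. 658; T. Bałaban, Commun. Math. Phys. **89** (1983)
571–597 [Balaban1983RegularityDecay] Thm (1.10) p. 573; T. Bałaban, Commun. Math. Phys. **109** (1987) 249–301 [Balaban1987RG1]
— Thm 1 p. 259 (uniformity in ε, the only printed trace of NE5).  No claim about the mass gap.
-/

noncomputable section

namespace Summit.QuantumFields.YangMills.BalabanUVNodes.N18KingModelTorusHolderDeriv

open Real Matrix
open Literature.MathematicalPhysics.QuantumFieldTheory.Balaban1983to89 (Params)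
open Literature.MathematicalPhysics.QuantumFieldTheory.Balaban1983to89.T4OutputRate (Carriers Functional NE5)
open Literature.MathematicalPhysics.QuantumFieldTheory.Balaban1983to89.B5Prop11Plancherel (Tor fine unitVec)
open Literature.MathematicalPhysics.QuantumFieldTheory.Balaban1983to89.B4Sect5Proof (latticeConst latticeConst_nonneg)
open Literature.MathematicalPhysics.QuantumFieldTheory.King1986
  (aK lemma43Const prop38RateConst prop38PosConst fprop38RateConst fprop38PosConst exp_decay_mono)
open Literature.MathematicalPhysics.QuantumFieldTheory.King1986.Torus
  (minimiser effLaplacian blockProj blockOf blockOf_over tdistT tdistT_symm tdistT_nonneg holdist K45 K45_nonneg delta45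
    gam0L gam0L_pos delta45_pos minimiser_col_decay minimiser_row_rate holder_dkernel_decay_blocks
    king_prop38_holder_deriv_torus_blocks)
open Summit.QuantumFields.YangMills.BalabanUVNodes.N18KingModelTorus (outerRate_le_unif)
open Summit.QuantumFields.YangMills.BalabanUVNodes.N18KingModelScalesPair
  (ne5_of_threeFactorRates_lemma45_pair fprop38Const_le_unif sqrt_rate_le_unif aliasConst_nonneg_of_lt_one)

variable {d : ℕ}

/-! ## §1 (3.75), second line (`∂^η_μ` inside the Hölder quotient), `j ≥ 1`, on Bałaban's tori: every outer line BY NAME -/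

/-- **KING'S (3.75), SECOND LINE (THE HÖLDER QUOTIENT OF THE LATTICE DERIVATIVE `∂_α(x, y)∂^η_μ` ON THE LEFT EXTERNAL LINE),
`j ≥ 1`, AS A MULTI-SCALE INHABITANT OF N18's DECL OF RECORD — UNCONDITIONAL FOR KING'S ACTUAL OPERATORS ON BAŁABAN'S
TORI.**  For `d ≥ 1`, odd `L > 1`, `a > 0`, `m² > 0`, `0 < α`, `0 < γ`, `α + γ < 1` there are `κ > 0`, `C₅ ≥ 0` (functions
of `d, L, a, m², γ, α` only) such that: for every `n ≥ 1`; every family of unit tori `L·M_j(μ) = 2L^{m_j}`; every carriers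
`C` with `1 ≤ scale X` whose domain `X` of scale `j` reads a direction `μ(X)` and three fine points `x_A`, `y_A`, `z_A`
under `x_B`, `y_B`, `z_B`, tree length `≤ dist({B(x_A), B(y_A)}, B(z_A))`; every two functionals reading the (4.42)
graphs with the row `u ↦ |x_A − y_A|^{−α}(∂^η_μℋ_j(x_A, u) − ∂^η_μℋ_j(y_A, u))`, `∂^η_μℋ_j(x, u) = L^j(ℋ_j(x + e_μ, u) − ℋ_j(x, u))`
(run B at `j + n` with primes); every window: `NE5 EA EB W κ (L^{−γ∕2}) C₅`.  Composition as the sibling's §1 with `hu` ≔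
`holder_dkernel_decay_blocks`, `hdu` ≔ `king_prop38_holder_deriv_torus_blocks` (∘ `fprop38Const_le_unif` at `β = α + 1`,
∘ `sqrt_rate_le_unif`). [cite: King1986, Prop. 3.9 (3.75) p.665, (3.62) p.663, (4.42)–(4.43) p.675, Prop. 3.8 (3.71) p.664] -/
theorem ne5_kingModel_threeFactorHolderDeriv_torus (hd : 1 ≤ d) (L : ℕ) [NeZero L] (hLp : Odd L ∧ 1 < L) {a m2 : ℝ}
    (ha : 0 < a) (hm : 0 < m2) {α γ : ℝ} (hα : 0 < α) (hγ : 0 < γ) (hαγ : α + γ < 1) :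
    ∃ κ C₅ : ℝ, 0 < κ ∧ 0 ≤ C₅ ∧
      ∀ (n : ℕ) (_hn : 1 ≤ n) (M : ℕ → Fin d → ℕ) [∀ j μ, NeZero (M j μ)]
        (_hM : ∀ j, ∃ mm : ℕ, ∀ μ, L * M j μ = 2 * L ^ mm)
        (C : Carriers) (_hsc : ∀ X, 1 ≤ C.scale X) (dir : C.Dom → Fin d)
        (xA yA zA : (X : C.Dom) → Tor (fine (L ^ C.scale X) (fine L (M (C.scale X)))))
        (xB yB zB : (X : C.Dom) → Tor (fine (L ^ n * L ^ C.scale X) (fine L (M (C.scale X)))))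
        (_hx : ∀ X μ, (xA X μ).val = (xB X μ).val / L ^ n)
        (_hy : ∀ X μ, (yA X μ).val = (yB X μ).val / L ^ n)
        (_hz : ∀ X μ, (zA X μ).val = (zB X μ).val / L ^ n)
        (_hd : ∀ X, C.d X ≤ min
            (tdistT (fine L (M (C.scale X))) (blockOf (L ^ C.scale X) (fine L (M (C.scale X))) (xA X))
              (blockOf (L ^ C.scale X) (fine L (M (C.scale X))) (zA X)))
            (tdistT (fine L (M (C.scale X))) (blockOf (L ^ C.scale X) (fine L (M (C.scale X))) (yA X))
              (blockOf (L ^ C.scale X) (fine L (M (C.scale X))) (zA X))))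
        (EA : Functional C C.BgA) (EB : Functional C C.BgB)
        (_hEA : ∀ g U X, EA g U X =
          (fun u => (holdist (L ^ C.scale X) (fine L (M (C.scale X))) (xA X) (yA X)) ^ (-α)
              * (((L ^ C.scale X : ℕ) : ℝ)
                  * (minimiser (L ^ C.scale X) (fine L (M (C.scale X))) (aK a L (C.scale X))
                        (((L ^ C.scale X : ℕ) : ℝ) ^ 2) m2 (Pi.single u 1)
                        (xA X + unitVec (fine (L ^ C.scale X) (fine L (M (C.scale X)))) (dir X))
                      - minimiser (L ^ C.scale X) (fine L (M (C.scale X))) (aK a L (C.scale X))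
                        (((L ^ C.scale X : ℕ) : ℝ) ^ 2) m2 (Pi.single u 1) (xA X))
                - ((L ^ C.scale X : ℕ) : ℝ)
                  * (minimiser (L ^ C.scale X) (fine L (M (C.scale X))) (aK a L (C.scale X))
                        (((L ^ C.scale X : ℕ) : ℝ) ^ 2) m2 (Pi.single u 1)
                        (yA X + unitVec (fine (L ^ C.scale X) (fine L (M (C.scale X)))) (dir X))
                      - minimiser (L ^ C.scale X) (fine L (M (C.scale X))) (aK a L (C.scale X))
                        (((L ^ C.scale X : ℕ) : ℝ) ^ 2) m2 (Pi.single u 1) (yA X))))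
            ⬝ᵥ ((effLaplacian (L ^ C.scale X) (fine L (M (C.scale X))) (aK a L (C.scale X))
                    (((L ^ C.scale X : ℕ) : ℝ) ^ 2) m2
                  + (a * ((L : ℝ) ^ 2)⁻¹) • blockProj L (M (C.scale X)))⁻¹
                *ᵥ fun w => minimiser (L ^ C.scale X) (fine L (M (C.scale X))) (aK a L (C.scale X))
                    (((L ^ C.scale X : ℕ) : ℝ) ^ 2) m2 (Pi.single w 1) (zA X)))
        (_hEB : ∀ g U X, EB g U X =
          (fun u => (holdist (L ^ n * L ^ C.scale X) (fine L (M (C.scale X))) (xB X) (yB X)) ^ (-α)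
              * (((L ^ n * L ^ C.scale X : ℕ) : ℝ)
                  * (minimiser (L ^ n * L ^ C.scale X) (fine L (M (C.scale X))) (aK a L (C.scale X + n))
                        (((L ^ n * L ^ C.scale X : ℕ) : ℝ) ^ 2) m2 (Pi.single u 1)
                        (xB X + unitVec (fine (L ^ n * L ^ C.scale X) (fine L (M (C.scale X)))) (dir X))
                      - minimiser (L ^ n * L ^ C.scale X) (fine L (M (C.scale X))) (aK a L (C.scale X + n))
                        (((L ^ n * L ^ C.scale X : ℕ) : ℝ) ^ 2) m2 (Pi.single u 1) (xB X))
                - ((L ^ n * L ^ C.scale X : ℕ) : ℝ)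
                  * (minimiser (L ^ n * L ^ C.scale X) (fine L (M (C.scale X))) (aK a L (C.scale X + n))
                        (((L ^ n * L ^ C.scale X : ℕ) : ℝ) ^ 2) m2 (Pi.single u 1)
                        (yB X + unitVec (fine (L ^ n * L ^ C.scale X) (fine L (M (C.scale X)))) (dir X))
                      - minimiser (L ^ n * L ^ C.scale X) (fine L (M (C.scale X))) (aK a L (C.scale X + n))
                        (((L ^ n * L ^ C.scale X : ℕ) : ℝ) ^ 2) m2 (Pi.single u 1) (yB X))))
            ⬝ᵥ ((effLaplacian (L ^ n * L ^ C.scale X) (fine L (M (C.scale X))) (aK a L (C.scale X + n))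
                    (((L ^ n * L ^ C.scale X : ℕ) : ℝ) ^ 2) m2
                  + (a * ((L : ℝ) ^ 2)⁻¹) • blockProj L (M (C.scale X)))⁻¹
                *ᵥ fun w => minimiser (L ^ n * L ^ C.scale X) (fine L (M (C.scale X))) (aK a L (C.scale X + n))
                    (((L ^ n * L ^ C.scale X : ℕ) : ℝ) ^ 2) m2 (Pi.single w 1) (zB X)))
        (W : Set (ℕ → ℝ)),
        NE5 EA EB W κ ((L : ℝ) ^ (-(γ / 2))) C₅ := by
  have hd0 : 0 < d := hd
  have hL2 : 2 ≤ L := by have := hLp.2; omega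
  have hα1 : α < 1 := by linarith
  have hγ1 : γ ≤ 1 := by linarith
  -- the outer-line packages BY NAME: the derivative Hölder row (file 13 §5–§6), the column (file 8)
  obtain ⟨δ₁, c₁, hδ₁, hc₁, H₁⟩ := holder_dkernel_decay_blocks d L hd hLp.1 hL2 ha hm hα hα1
  obtain ⟨δ₂, c₂, hδ₂, hc₂, H₂⟩ := minimiser_col_decay d L hd hLp ha hm.le
  obtain ⟨δ₃, c₃, hδ₃, hc₃, H₃⟩ := king_prop38_holder_deriv_torus_blocks d L hd hLp.1 hL2 ha hm hα hγ hαγ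
  obtain ⟨δ₄, c₄, hδ₄, hc₄, H₄⟩ := minimiser_row_rate d L hd hLp.1 hL2 ha hm hγ.le hγ1
  have hδ45 : 0 < delta45 d a L := delta45_pos (d := d) ha hL2
  set κ : ℝ := min (min (min δ₁ δ₂) (min (δ₃ / 2) (δ₄ / 2))) (delta45 d a L) with hκ_def
  have hκpos : 0 < κ :=
    lt_min (lt_min (lt_min hδ₁ hδ₂) (lt_min (half_pos hδ₃) (half_pos hδ₄))) hδ45
  have hκ₁ : κ ≤ δ₁ := (min_le_left _ _).trans ((min_le_left _ _).trans (min_le_left _ _))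
  have hκ₂ : κ ≤ δ₂ := (min_le_left _ _).trans ((min_le_left _ _).trans (min_le_right _ _))
  have hκ₃ : κ ≤ δ₃ / 2 := (min_le_left _ _).trans ((min_le_right _ _).trans (min_le_left _ _))
  have hκ₄ : κ ≤ δ₄ / 2 := (min_le_left _ _).trans ((min_le_right _ _).trans (min_le_right _ _))
  have hκ45 : κ ≤ delta45 d a L := min_le_right _ _
  set Cu : ℝ := prop38RateConst a a (a * (2 * ((a * (1 - ((L : ℝ) ^ 2)⁻¹))⁻¹ + π ^ 2 / 48 + 1 / 3)))
      ((π ^ 2 / 4) ^ d) d γ + prop38PosConst a ((π ^ 2 / 4) ^ d) d γ with hCu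
  set CuH : ℝ := fprop38RateConst a a (a * (2 * ((a * (1 - ((L : ℝ) ^ 2)⁻¹))⁻¹ + π ^ 2 / 48 + 1 / 3)))
      ((π ^ 2 / 4) ^ d) d γ (α + 1) (2 * (d : ℝ) ^ α) (2 * (d : ℝ) ^ α * 2 ^ (1 - γ))
      + fprop38PosConst a ((π ^ 2 / 4) ^ d) d γ (α + 1) (2 * (d : ℝ) ^ α) (6 * (d : ℝ) ^ (α + γ)) with hCuH
  set cA : ℝ := Real.sqrt (2 * c₃ * CuH) with hcA
  set cB : ℝ := Real.sqrt (2 * (a * c₄) * Cu) with hcB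
  have hcA0 : 0 ≤ cA := Real.sqrt_nonneg _
  have hcB0 : 0 ≤ cB := Real.sqrt_nonneg _
  have hsB : 0 ≤ a * c₂ := by positivity
  have hγ₀ : 0 < gam0L d a L := gam0L_pos ha hL2
  have hK45 : 0 ≤ K45 d a L := K45_nonneg a L
  have hKd : 0 ≤ latticeConst d (κ / 2) := latticeConst_nonneg d (half_pos hκpos).le
  have hAC : 0 ≤ Literature.MathematicalPhysics.QuantumFieldTheory.King1986.aliasConst d (α + 1 + γ - 1) :=
    aliasConst_nonneg_of_lt_one hd0 (by linarith)
  refine ⟨κ / 2, 2 * ((cA * (2 / gam0L d a L) * (a * c₂) + c₁ * K45 d a L * (a * c₂)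
      + c₁ * (2 / gam0L d a L) * cB) * (latticeConst d (κ / 2)) ^ 2), half_pos hκpos, by positivity, ?_⟩
  intro n hn M _ hM C hsc dir xA yA zA xB yB zB hx hy hz hdd EA EB hEA hEB W
  have hγ2 : γ / 2 ≤ 1 := by linarith
  refine ne5_of_threeFactorRates_lemma45_pair (C := C) (EA := EA) (EB := EB) (W := W) L hL2 ha hm hn M hγ2 hsc
    (fun X => blockOf (L ^ C.scale X) (fine L (M (C.scale X))) (xA X))
    (fun X => blockOf (L ^ C.scale X) (fine L (M (C.scale X))) (yA X))
    (fun X => blockOf (L ^ C.scale X) (fine L (M (C.scale X))) (zA X))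
    (fun X u => (holdist (L ^ C.scale X) (fine L (M (C.scale X))) (xA X) (yA X)) ^ (-α)
      * (((L ^ C.scale X : ℕ) : ℝ)
          * (minimiser (L ^ C.scale X) (fine L (M (C.scale X))) (aK a L (C.scale X))
                (((L ^ C.scale X : ℕ) : ℝ) ^ 2) m2 (Pi.single u 1)
                (xA X + unitVec (fine (L ^ C.scale X) (fine L (M (C.scale X)))) (dir X))
              - minimiser (L ^ C.scale X) (fine L (M (C.scale X))) (aK a L (C.scale X))
                (((L ^ C.scale X : ℕ) : ℝ) ^ 2) m2 (Pi.single u 1) (xA X))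
        - ((L ^ C.scale X : ℕ) : ℝ)
          * (minimiser (L ^ C.scale X) (fine L (M (C.scale X))) (aK a L (C.scale X))
                (((L ^ C.scale X : ℕ) : ℝ) ^ 2) m2 (Pi.single u 1)
                (yA X + unitVec (fine (L ^ C.scale X) (fine L (M (C.scale X)))) (dir X))
              - minimiser (L ^ C.scale X) (fine L (M (C.scale X))) (aK a L (C.scale X))
                (((L ^ C.scale X : ℕ) : ℝ) ^ 2) m2 (Pi.single u 1) (yA X))))
    (fun X u => (holdist (L ^ n * L ^ C.scale X) (fine L (M (C.scale X))) (xB X) (yB X)) ^ (-α)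
      * (((L ^ n * L ^ C.scale X : ℕ) : ℝ)
          * (minimiser (L ^ n * L ^ C.scale X) (fine L (M (C.scale X))) (aK a L (C.scale X + n))
                (((L ^ n * L ^ C.scale X : ℕ) : ℝ) ^ 2) m2 (Pi.single u 1)
                (xB X + unitVec (fine (L ^ n * L ^ C.scale X) (fine L (M (C.scale X)))) (dir X))
              - minimiser (L ^ n * L ^ C.scale X) (fine L (M (C.scale X))) (aK a L (C.scale X + n))
                (((L ^ n * L ^ C.scale X : ℕ) : ℝ) ^ 2) m2 (Pi.single u 1) (xB X))
        - ((L ^ n * L ^ C.scale X : ℕ) : ℝ)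
          * (minimiser (L ^ n * L ^ C.scale X) (fine L (M (C.scale X))) (aK a L (C.scale X + n))
                (((L ^ n * L ^ C.scale X : ℕ) : ℝ) ^ 2) m2 (Pi.single u 1)
                (yB X + unitVec (fine (L ^ n * L ^ C.scale X) (fine L (M (C.scale X)))) (dir X))
              - minimiser (L ^ n * L ^ C.scale X) (fine L (M (C.scale X))) (aK a L (C.scale X + n))
                (((L ^ n * L ^ C.scale X : ℕ) : ℝ) ^ 2) m2 (Pi.single u 1) (yB X))))
    (fun X w => minimiser (L ^ C.scale X) (fine L (M (C.scale X))) (aK a L (C.scale X))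
      (((L ^ C.scale X : ℕ) : ℝ) ^ 2) m2 (Pi.single w 1) (zA X))
    (fun X w => minimiser (L ^ n * L ^ C.scale X) (fine L (M (C.scale X))) (aK a L (C.scale X + n))
      (((L ^ n * L ^ C.scale X : ℕ) : ℝ) ^ 2) m2 (Pi.single w 1) (zB X))
    (fun X => (effLaplacian (L ^ C.scale X) (fine L (M (C.scale X))) (aK a L (C.scale X))
        (((L ^ C.scale X : ℕ) : ℝ) ^ 2) m2 + (a * ((L : ℝ) ^ 2)⁻¹) • blockProj L (M (C.scale X)))⁻¹)
    (fun X => (effLaplacian (L ^ n * L ^ C.scale X) (fine L (M (C.scale X))) (aK a L (C.scale X + n))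
        (((L ^ n * L ^ C.scale X : ℕ) : ℝ) ^ 2) m2 + (a * ((L : ℝ) ^ 2)⁻¹) • blockProj L (M (C.scale X)))⁻¹)
    (fun _ => rfl) (fun _ => rfl) hκpos hκ45 hc₁.le hsB hcA0 hcB0 ?_ ?_ ?_ ?_ hdd hEA hEB
  · -- `hu`: the derivative Hölder row, pair-anchored (`holder_dkernel_decay_blocks`)
    intro X u
    obtain ⟨mm, hmm⟩ := hM (C.scale X)
    have hMK : ∀ μ, fine L (M (C.scale X)) μ
        = (⟨d, L, mm, C.scale X, hd, hLp⟩ : Params).sitesPerDir (C.scale X) := fun μ => by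
      simp only [Params.sitesPerDir, Nat.add_sub_cancel]; exact hmm μ
    have h := H₁ ⟨d, L, mm, C.scale X, hd, hLp⟩ rfl rfl (hsc X) (fine L (M (C.scale X))) hMK (L ^ C.scale X) rfl
      (xA X) (yA X) u (dir X)
    exact h.trans (exp_decay_mono hc₁.le hκ₁ (le_min (tdistT_nonneg _ _ _) (tdistT_nonneg _ _ _)))
  · -- `hv`: run B's column (`minimiser_col_decay` ∘ `blockOf_over`)
    intro X w
    obtain ⟨mm, hmm⟩ := hM (C.scale X)
    have hMK : ∀ μ, fine L (M (C.scale X)) μ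
        = (⟨d, L, mm, C.scale X + n, hd, hLp⟩ : Params).sitesPerDir (C.scale X + n) := fun μ => by
      simp only [Params.sitesPerDir, Nat.add_sub_cancel]; exact hmm μ
    have hN : L ^ n * L ^ C.scale X = L ^ (C.scale X + n) := by rw [pow_add, mul_comm]
    have h := H₂ ⟨d, L, mm, C.scale X + n, hd, hLp⟩ rfl rfl (show 1 ≤ C.scale X + n by have := hsc X; omega)
      (fine L (M (C.scale X))) hMK (L ^ n * L ^ C.scale X) hN κ hκpos hκ₂ (zB X) w
    rw [blockOf_over (fine L (M (C.scale X))) (zA X) (zB X) (hz X)] at h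
    exact h
  · -- `hdu`: (3.71) line 4 in its printed shape (`king_prop38_holder_deriv_torus_blocks`), constant made `K, n`-free
    intro X u
    obtain ⟨mm, hmm⟩ := hM (C.scale X)
    have hMK : ∀ μ, fine L (M (C.scale X)) μ
        = (⟨d, L, mm, C.scale X, hd, hLp⟩ : Params).sitesPerDir (C.scale X) := fun μ => by
      simp only [Params.sitesPerDir, Nat.add_sub_cancel]; exact hmm μ
    haveI : NeZero (⟨d, L, mm, C.scale X, hd, hLp⟩ : Params).L := ‹NeZero L›
    have h := H₃ ⟨d, L, mm, C.scale X, hd, hLp⟩ rfl rfl (hsc X) n hn (fine L (M (C.scale X))) hMK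
      (xA X) (yA X) (xB X) (yB X) u (hx X) (hy X) (dir X)
    have hm0 : 0 ≤ min (tdistT (fine L (M (C.scale X))) (blockOf (L ^ C.scale X) (fine L (M (C.scale X))) (xA X)) u)
        (tdistT (fine L (M (C.scale X))) (blockOf (L ^ C.scale X) (fine L (M (C.scale X))) (yA X)) u) :=
      le_min (tdistT_nonneg _ _ _) (tdistT_nonneg _ _ _)
    refine (h.trans (exp_decay_mono (Real.sqrt_nonneg _) hκ₃ hm0)).trans ?_
    refine mul_le_mul_of_nonneg_right ?_ (Real.exp_pos _).le
    exact sqrt_rate_le_unif (fprop38Const_le_unif ha hL2 (hsc X) hn (by positivity) (by positivity) hAC)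
      (by positivity) L (C.scale X) γ
  · -- `hdv`: the column difference (`minimiser_row_rate` ∘ `outerRate_le_unif` ∘ `tdistT_symm`)
    intro X w
    obtain ⟨mm, hmm⟩ := hM (C.scale X)
    have hMK : ∀ μ, fine L (M (C.scale X)) μ
        = (⟨d, L, mm, C.scale X, hd, hLp⟩ : Params).sitesPerDir (C.scale X) := fun μ => by
      simp only [Params.sitesPerDir, Nat.add_sub_cancel]; exact hmm μ
    haveI : NeZero (⟨d, L, mm, C.scale X, hd, hLp⟩ : Params).L := ‹NeZero L›
    have h := H₄ ⟨d, L, mm, C.scale X, hd, hLp⟩ rfl rfl (hsc X) n hn (fine L (M (C.scale X))) hMK κ hκpos hκ₄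
      (zA X) (zB X) w (hz X)
    rw [tdistT_symm (fine L (M (C.scale X))) w]
    exact h.trans (mul_le_mul_of_nonneg_right (outerRate_le_unif hd0 ha hL2 (hsc X) hn hγ1 hc₄.le)
      (Real.exp_pos _).le)

end Summit.QuantumFields.YangMills.BalabanUVNodes.N18KingModelTorusHolderDeriv

end
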